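import Literature.Probability.Percolation.PercolationLevelOne
import Literature.Probability.Percolation.CorrelationLengthDKTProp5
import Literature.Probability.Percolation.CorrelationLengthDKTProofs
import Literature.Probability.Percolation.BondTwoArmsAKN
import Literature.Probability.Percolation.OneArmOSSSDiffIneqZd
import Literature.Probability.LatticeModels.LatticeGreenRiemannSum
import Summits.CriticalPhenomena.PercolationContinuityZ3.Theorems.PercNearOneGluingNoHeavyQuantThetaOneArmModulus
import HarnessLib

/-!
# QUANT lane (p4 gen 15): the Russo–Talagrand (Level-1) bound for the one-arm probability —
# `θ_n'(r) ≤ θ_n(r)·√(m_n·log(1/θ_n(r))/2)/(r(1−r))` — and its integrated form across `p_c`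

builds on p205010 (kernel theorem, internal audit signed; external expert review pending) — NOT used in this file.

Seat `prim-quant-p4` (METHOD = differential inequalities for `θ` near `p_c`), helper file
`--supports stmt-CriticalPhenomena-4575`; pure proofs, no definitions.  Notation: `θ_n(r) = DCT16.thetaN d n r =
P_r(0 ↔ ∂Λ_n)`, `m_n = #edgesIn(Λ_n) ≤ 2d(2n+1)^d` (`AKN.card_edgesIn_le`, `card_box`).

Gen 1 of this seat (R4, `…QuantThetaOneArmModulus`) integrated the Moore–Shannon / Chayes–Chayes–Fisher–Spencer bound
`θ_n' ≤ √(m_n θ_n(1−θ_n)/(r(1−r)))` (Grimmett 1999 Thm (2.36)(a)) to `√θ_n(p) ≤ √θ_n(q) + ((p−q)/2)√(m_n/(q(1−p)))`.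
The Level-1 inequality of Talagrand (O'Donnell 2014 §5.3; kernel on the biased cube with the sharp constant,
`Literature/Probability/Moments/BiasedCubeLevelOne.lean`, transferred to percolation events in
`Literature/Probability/Percolation/PercolationLevelOne.lean`, both this generation) replaces `√(θ_n(1−θ_n))` by
`θ_n√(log(1/θ_n)/2)/√(p(1−p))`, which is smaller exactly when the event is RARE:

* §1 `real_armEvent_zero_eq_thetaN` — `θ_n` is the probability of the lattice-step arm event `DKT20.armEvent 0 n`
  (increasing, determined by the `m_n` lattice edges inside `Λ_n`).
* §2 **`deriv_thetaN_le_levelOne`** — for `d ≥ 1`, `r ∈ (0,1)`, every `n`: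
  `θ_n'(r) ≤ θ_n(r)·√(m_n·log(1/θ_n(r))/2)/(r(1−r))` (`HasDerivAt` form `hasDerivAt_thetaN_le_levelOne`).
* §3 **`sqrt_log_thetaN_ge`** — integrated (the function `r ↦ √(log(1/θ_n(r)))` has slope `≥ −√(m_n/8)/(r(1−r))`):
  for `0 < q ≤ p < 1`, `√(log(1/θ_n(p))) ≥ √(log(1/θ_n(q))) − √(m_n/8)·(p−q)/(q(1−p))`, i.e.
  **`θ_n(p) ≤ exp(−[√(log(1/θ_n(q))) − √(m_n/8)(p−q)/(q(1−p))]₊²)`** (`thetaN_le_exp_neg_sq`).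
* §4 at `q = p_c` (`d ≥ 2`, `p_c < p < 1`): **`θ(p) ≤ θ_n(p) ≤ exp(−[√(log(1/π_n(p_c))) − √(m_n/8)(p−p_c)/(p_c(1−p))]₊²)`**
  for every `n` (`theta_le_exp_neg_sq_critical`) — explicit modulo the critical profile `π_n(p_c)`, like R4.
* §5 **OSSS × Level-1 ("Menshikov made two-sided by Talagrand")**: with `I_e(r) = P_r(e pivotal)`, `S_n = Σ_{k<n} θ_k`,
  the DRT/OSSS lower bound `n θ_n(1−θ_n) ≤ 4r(1−r) S_n Σ_e I_e` (tree, `OneArmOSSS.oneArm_deriv_ge`) and the Level-1 upper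
  bound `Σ_e I_e² ≤ θ_n² log(1/θ_n)/(2r²(1−r)²)` combine, `r`-FREE, to
  **`(n(1−θ_n))²·Σ_e I_e² ≤ 8·S_n²·log(1/θ_n)·(Σ_e I_e)²`** (`sq_mul_sum_sq_pivotal_le`): the "effective number"
  `(Σ_e I_e)²/Σ_e I_e²` of pivotal edges of `{0 ↔ ∂Λ_n}` is at least `n²(1−θ_n)²/(8 S_n² log(1/θ_n))` at every `r ∈ (0,1)`
  (new as typed; at `p_c` the factor `(n/S_n)²` diverges by p205010 while `log(1/π_n) ≤ ((d−1)/2) log n + O(1)` by the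
  tree's one-arm floor — no unconditional divergence is claimed).

HONEST COMPARISON (no rate is claimed; (T1)/(T2) unchanged).  Against R4's `θ ≤ (√π_n + s√(m_n/(4p_c(1−p))))²` the
new bound wins iff `π_n(p_c)` is small enough that `log(1/π_n) ≳ 1/(p_c(1−p_c))`, i.e. only at scales where the
critical one-arm probability is already tiny (on `ℤ³`, with the census value `π(64) ≈ 0.13`, NOT at accessible scales);
under a hypothetical rate `π_n ≤ Cn^{−c}` it gives the (T1) ⇒ (T2) exponent `2c/d·(1 − o(1))` — the same exponent as
the Newman-volume transfer already in the tree (`ThetaModulus.thetaHolderNearCritical_of_oneArmPolyDecay_volume`, `2c/d`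
with a constant), better than R4.b's `2c/(c+d)`.  So this file is the kernel form of census variant V13 (P4-MODULUS §11),
recorded as a TOOL (the derivative bound §2 holds at every `r` and every scale), not as progress on the modulus.

## References
* R. O'Donnell, *Analysis of Boolean Functions* (2014), §5.3 "Level-1 Inequality" [ODonnell2014].
* M. Talagrand, Combinatorica 16 (1996) 243–258 [Talagrand1996].
* G. Grimmett, *Percolation*, 2nd ed. (1999), Thm (2.36)(a), §1.4 [GrimmettPercolation1999].
* L. Russo, Z. Wahrsch. verw. Gebiete 56 (1981), Lemma 3 [RussoZW1981].
-/

noncomputable section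

namespace Summit.CriticalPhenomena.PercolationContinuityZ3.Theorems

namespace OneArmLevelOne

open MeasureTheory Set Literature.Probability.Percolation Literature.Probability.LatticeModels
open scoped Classical

variable {d : ℕ}

/-! ### §1. `θ_n` as the probability of the lattice-step arm event -/

/-- **`P_r(armEvent 0 n) = θ_n(r)`**: the lattice-step arm event from `Λ_0 = {0}` to `∂ⁱⁿΛ_n` inside `Λ_n` has the
probability of `{0 ↔ ∂Λ_n}` (they differ only on configurations using non-lattice pairs, a null set). -/
theorem real_armEvent_zero_eq_thetaN (n : ℕ) (r : ℝ) :
    (bondPercolation (zdGraph d) (projIcc 0 1 zero_le_one r)).real (DKT20.armEvent 0 n) = DCT16.thetaN d n r := by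
  rw [DKT20.real_armEvent_eq _ (Nat.zero_le n)]
  show _ = (bondPercolation (zdGraph d) (projIcc 0 1 zero_le_one r)).real (siteToBoundary d n)
  congr 1
  ext ω
  simp only [linkEvent, box_zero_eq, Finset.mem_singleton, exists_eq_left, Set.mem_setOf_eq, siteToBoundary]

/-! ### §2. The Level-1 derivative bound for `θ_n` -/

/-- The number of lattice edges inside `Λ_n`: `m_n ≤ 2d(2n+1)^d`. -/
theorem card_edgesIn_box_le (d n : ℕ) : ((edgesIn (zdGraph d) (box d n)).card : ℝ) ≤ 2 * d * (2 * n + 1) ^ d := by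
  have h := AKN.card_edgesIn_le (d := d) (box d n)
  rw [card_box] at h
  exact_mod_cast h

/-- **Russo–Talagrand for the one-arm probability (`HasDerivAt` form)**: for `r ∈ (0,1)` and every `n`, `θ_n` is
differentiable at `r` with derivative `Σ_{e ∈ edgesIn Λ_n} P_r(e pivotal for the arm event)`, and this derivative is
`≤ θ_n(r)·√(m_n·log(1/θ_n(r))/2)/(r(1−r))`, `m_n = #edgesIn(Λ_n)`. -/
theorem hasDerivAt_thetaN_le_levelOne (n : ℕ) {r : ℝ} (hr : r ∈ Set.Ioo (0 : ℝ) 1) :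
    ∃ D : ℝ, HasDerivAt (DCT16.thetaN d n) D r ∧ 0 ≤ D ∧
      D ≤ DCT16.thetaN d n r *
          Real.sqrt ((edgesIn (zdGraph d) (box d n)).card * (-Real.log (DCT16.thetaN d n r)) / 2) / (r * (1 - r)) := by
  have hF := DKT20.coe_edgesIn_subset (d := d) n
  have hA := DKT20.isUpperSet_armEvent (d := d) 0 n
  have hAF := DKT20.determinedBy_armEvent (d := d) 0 n
  have hderiv := SharpThreshold.hasDerivAt_real_event hF hA hAF hr
  have hfun : (fun q : ℝ => (bondPercolation (zdGraph d) (Set.projIcc 0 1 zero_le_one q)).real (DKT20.armEvent 0 n)) =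
      DCT16.thetaN d n := funext fun q => real_armEvent_zero_eq_thetaN n q
  rw [hfun] at hderiv
  refine ⟨_, hderiv, Finset.sum_nonneg fun e _ => measureReal_nonneg, ?_⟩
  have hcoe : ((Set.projIcc (0 : ℝ) 1 zero_le_one r : unitInterval) : ℝ) = r :=
    congrArg Subtype.val (Set.projIcc_of_mem zero_le_one ⟨hr.1.le, hr.2.le⟩)
  have h := LevelOne.sum_pivotal_le_event hF hA hAF (Set.projIcc 0 1 zero_le_one r)
    (by rw [hcoe]; exact hr.1) (by rw [hcoe]; exact hr.2)
  rw [real_armEvent_zero_eq_thetaN n r, hcoe] at h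
  exact h

/-- **Russo–Talagrand for the one-arm probability**: for `r ∈ (0,1)` and every `n`,
`θ_n'(r) ≤ θ_n(r)·√(m_n·log(1/θ_n(r))/2)/(r(1−r))`, `m_n = #edgesIn(Λ_n) ≤ 2d(2n+1)^d` — to be compared with the
Moore–Shannon / CCFS bound `θ_n'(r) ≤ √(m_n θ_n(1−θ_n)/(r(1−r)))` (Grimmett (2.36)(a)). -/
theorem deriv_thetaN_le_levelOne (n : ℕ) {r : ℝ} (hr : r ∈ Set.Ioo (0 : ℝ) 1) :
    deriv (DCT16.thetaN d n) r ≤ DCT16.thetaN d n r *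
        Real.sqrt ((edgesIn (zdGraph d) (box d n)).card * (-Real.log (DCT16.thetaN d n r)) / 2) / (r * (1 - r)) := by
  obtain ⟨D, hD, -, hle⟩ := hasDerivAt_thetaN_le_levelOne (d := d) n hr
  rw [hD.deriv]; exact hle

/-! ### §3. Integration: `√(log(1/θ_n))` has slope `≥ −√(m_n/8)/(r(1−r))` -/

/-- `0 < θ_n(r) < 1` for `r ∈ (0,1)`, `d ≥ 1`, `n ≥ 1`. -/
theorem thetaN_mem_Ioo (hd : 1 ≤ d) {n : ℕ} (hn : 1 ≤ n) {r : ℝ} (hr : r ∈ Set.Ioo (0 : ℝ) 1) :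
    DCT16.thetaN d n r ∈ Set.Ioo (0 : ℝ) 1 := by
  have hcoe : ((Set.projIcc (0 : ℝ) 1 zero_le_one r : unitInterval) : ℝ) = r :=
    congrArg Subtype.val (Set.projIcc_of_mem zero_le_one ⟨hr.1.le, hr.2.le⟩)
  refine ⟨DKT20.real_siteToBoundary_pos hd _ (by rw [hcoe]; exact hr.1) n, ?_⟩
  change (bondPercolation (zdGraph d) (projIcc 0 1 zero_le_one r)).real (siteToBoundary d n) < 1
  exact (DCT16.real_siteToBoundary_antitone _ hn).trans_lt
    (DCT16.real_siteToBoundary_one_lt_one _ (by rw [hcoe]; exact hr.2))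

/-- **The integrated Level-1 bound**: for `d ≥ 1`, `n ≥ 1` and `0 < q ≤ p < 1`,
`√(log(1/θ_n(p))) ≥ √(log(1/θ_n(q))) − √(m_n/8)·(p − q)/(q(1−p))`
(the function `r ↦ √(−log θ_n(r)) + √(m_n/8)·r/(q(1−p))` is non-decreasing on `[q,p]`, its derivative being
`−θ_n'/(2θ_n√(−log θ_n)) + √(m_n/8)/(q(1−p)) ≥ 0` by §2 and `r(1−r) ≥ q(1−p)`). -/
theorem sqrt_log_thetaN_ge (hd : 1 ≤ d) {n : ℕ} (hn : 1 ≤ n) {q p : ℝ} (hq : 0 < q) (hqp : q ≤ p) (hp : p < 1) :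
    Real.sqrt (-Real.log (DCT16.thetaN d n q)) -
        Real.sqrt ((edgesIn (zdGraph d) (box d n)).card / 8) * ((p - q) / (q * (1 - p))) ≤
      Real.sqrt (-Real.log (DCT16.thetaN d n p)) := by
  set m : ℝ := ((edgesIn (zdGraph d) (box d n)).card : ℝ) with hm
  have hm0 : 0 ≤ m := Nat.cast_nonneg _
  set K : ℝ := Real.sqrt (m / 8) / (q * (1 - p)) with hK
  have hqp0 : 0 < q * (1 - p) := mul_pos hq (by linarith)
  have hK0 : 0 ≤ K := div_nonneg (Real.sqrt_nonneg _) hqp0.le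
  set Y : ℝ → ℝ := fun r => Real.sqrt (-Real.log (DCT16.thetaN d n r)) + K * r with hY
  -- the derivative of `Y` on `(0,1)` and its sign on `[q,p]`
  have hderivY : ∀ r ∈ Set.Icc q p, ∃ D', HasDerivAt Y D' r ∧ 0 ≤ D' := by
    intro r hr
    have hr01 : r ∈ Set.Ioo (0 : ℝ) 1 := ⟨hq.trans_le hr.1, hr.2.trans_lt hp⟩
    obtain ⟨D, hD, hD0, hDle⟩ := hasDerivAt_thetaN_le_levelOne (d := d) n hr01
    have hθ := thetaN_mem_Ioo hd hn hr01
    have hL0 : 0 < -Real.log (DCT16.thetaN d n r) := by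
      rw [neg_pos]; exact Real.log_neg hθ.1 hθ.2
    have hsL : 0 < Real.sqrt (-Real.log (DCT16.thetaN d n r)) := Real.sqrt_pos.2 hL0
    -- `(√(−log θ_n))' = (−θ'/θ)/(2√L)`
    have h1 : HasDerivAt (fun r => -Real.log (DCT16.thetaN d n r)) (-(D / DCT16.thetaN d n r)) r :=
      (hD.log hθ.1.ne').neg
    have h2 : HasDerivAt (fun r => Real.sqrt (-Real.log (DCT16.thetaN d n r)))
        (-(D / DCT16.thetaN d n r) / (2 * Real.sqrt (-Real.log (DCT16.thetaN d n r)))) r :=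
      h1.sqrt hL0.ne'
    have h3 : HasDerivAt Y (-(D / DCT16.thetaN d n r) / (2 * Real.sqrt (-Real.log (DCT16.thetaN d n r))) + K * 1) r :=
      h2.add ((hasDerivAt_id r).const_mul K)
    refine ⟨_, h3, ?_⟩
    -- `D/θ ≤ √(mL/2)/(r(1−r)) ≤ √(mL/2)/(q(1−p))`, and `√(mL/2)/(2√L) = √(m/8)`
    have hrr : q * (1 - p) ≤ r * (1 - r) := by nlinarith [hr.1, hr.2]
    have hDθ : D / DCT16.thetaN d n r ≤
        Real.sqrt (m * (-Real.log (DCT16.thetaN d n r)) / 2) / (q * (1 - p)) := by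
      rw [div_le_iff₀ hθ.1]
      calc D ≤ DCT16.thetaN d n r * Real.sqrt (m * (-Real.log (DCT16.thetaN d n r)) / 2) / (r * (1 - r)) := hDle
        _ ≤ DCT16.thetaN d n r * Real.sqrt (m * (-Real.log (DCT16.thetaN d n r)) / 2) / (q * (1 - p)) :=
            div_le_div_of_nonneg_left (mul_nonneg hθ.1.le (Real.sqrt_nonneg _)) hqp0 hrr
        _ = Real.sqrt (m * (-Real.log (DCT16.thetaN d n r)) / 2) / (q * (1 - p)) * DCT16.thetaN d n r := by ring
    have hsqrt : Real.sqrt (m * (-Real.log (DCT16.thetaN d n r)) / 2) =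
        Real.sqrt (m / 8) * (2 * Real.sqrt (-Real.log (DCT16.thetaN d n r))) := by
      have h4 : Real.sqrt 4 = 2 := by
        rw [show (4:ℝ) = 2 ^ 2 by norm_num, Real.sqrt_sq (by norm_num)]
      rw [← h4, ← Real.sqrt_mul (by norm_num : (0:ℝ) ≤ 4), ← Real.sqrt_mul (by positivity : 0 ≤ m / 8)]
      congr 1; ring
    have hkey : D / DCT16.thetaN d n r / (2 * Real.sqrt (-Real.log (DCT16.thetaN d n r))) ≤ K := by
      rw [div_le_iff₀ (by positivity), hK]
      calc D / DCT16.thetaN d n r ≤ Real.sqrt (m * (-Real.log (DCT16.thetaN d n r)) / 2) / (q * (1 - p)) := hDθ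
        _ = Real.sqrt (m / 8) / (q * (1 - p)) * (2 * Real.sqrt (-Real.log (DCT16.thetaN d n r))) := by
            rw [hsqrt]; ring
    have : -(D / DCT16.thetaN d n r) / (2 * Real.sqrt (-Real.log (DCT16.thetaN d n r))) =
        -(D / DCT16.thetaN d n r / (2 * Real.sqrt (-Real.log (DCT16.thetaN d n r)))) := by ring
    rw [this]
    linarith
  have hcont : ContinuousOn Y (Set.Icc q p) := fun r hr => by
    obtain ⟨D', hD', -⟩ := hderivY r hr
    exact hD'.continuousAt.continuousWithinAt
  have hmono : MonotoneOn Y (Set.Icc q p) := by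
    refine monotoneOn_of_deriv_nonneg (convex_Icc q p) hcont ?_ ?_
    · rw [interior_Icc]
      intro r hr
      obtain ⟨D', hD', -⟩ := hderivY r (Set.Ioo_subset_Icc_self hr)
      exact hD'.differentiableAt.differentiableWithinAt
    · rw [interior_Icc]
      intro r hr
      obtain ⟨D', hD', hD'0⟩ := hderivY r (Set.Ioo_subset_Icc_self hr)
      rw [hD'.deriv]; exact hD'0
  have h := hmono (Set.left_mem_Icc.2 hqp) (Set.right_mem_Icc.2 hqp) hqp
  simp only [hY] at h
  have hK' : K * p - K * q = Real.sqrt (m / 8) * ((p - q) / (q * (1 - p))) := by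
    rw [hK]; field_simp
  linarith

/-- `exp(−[a]₊²)` form: if `√(−log x) ≥ a` for `x ∈ (0,1]`... precisely, for `0 < x` with `b ≤ √(−log x)`:
`x ≤ exp(−(max b 0)²)`. -/
theorem le_exp_neg_sq_of_le_sqrt_neg_log {x b : ℝ} (hx : 0 < x) (hx1 : x ≤ 1) (hb : b ≤ Real.sqrt (-Real.log x)) :
    x ≤ Real.exp (-(max b 0) ^ 2) := by
  have hL : 0 ≤ -Real.log x := by rw [neg_nonneg]; exact Real.log_nonpos hx.le hx1
  have hmax : max b 0 ≤ Real.sqrt (-Real.log x) := max_le hb (Real.sqrt_nonneg _)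
  have hsq : (max b 0) ^ 2 ≤ -Real.log x := by
    calc (max b 0) ^ 2 ≤ Real.sqrt (-Real.log x) ^ 2 := pow_le_pow_left₀ (le_max_right _ _) hmax 2
      _ = -Real.log x := Real.sq_sqrt hL
  calc x = Real.exp (Real.log x) := (Real.exp_log hx).symm
    _ ≤ Real.exp (-(max b 0) ^ 2) := Real.exp_le_exp.2 (by linarith)

/-- **The integrated Level-1 bound, exponential form**: for `d ≥ 1`, `n ≥ 1`, `0 < q ≤ p < 1`,
`θ_n(p) ≤ exp(−[√(log(1/θ_n(q))) − √(m_n/8)·(p−q)/(q(1−p))]₊²)`. -/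
theorem thetaN_le_exp_neg_sq (hd : 1 ≤ d) {n : ℕ} (hn : 1 ≤ n) {q p : ℝ} (hq : 0 < q) (hqp : q ≤ p) (hp : p < 1) :
    DCT16.thetaN d n p ≤ Real.exp (-(max (Real.sqrt (-Real.log (DCT16.thetaN d n q)) -
        Real.sqrt ((edgesIn (zdGraph d) (box d n)).card / 8) * ((p - q) / (q * (1 - p)))) 0) ^ 2) := by
  have hθp := thetaN_mem_Ioo hd hn ⟨hq.trans_le hqp, hp⟩
  exact le_exp_neg_sq_of_le_sqrt_neg_log hθp.1 hθp.2.le (sqrt_log_thetaN_ge hd hn hq hqp hp)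

/-! ### §4. At `p_c`: a modulus of `θ` explicit modulo the critical one-arm profile -/

/-- **Level-1 modulus of `θ` at `p_c⁺`** (every `d ≥ 2`, `p_c < p < 1`, every `n ≥ 1`):
`θ(p) ≤ θ_n(p) ≤ exp(−[√(log(1/π_n(p_c))) − √(m_n/8)·(p − p_c)/(p_c(1−p))]₊²)`, `m_n = #edgesIn(Λ_n) ≤ 2d(2n+1)^d`,
`π_n(p_c) = θ_n(p_c)` — explicit modulo the critical one-arm probabilities, like R4's
`θ(p) ≤ (√π_n(p_c) + (p−p_c)√(m/(4p_c(1−p))))²` (`ThetaModulus.theta_le_sq_sqrt_oneArm_add`), and smaller than it exactly when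
`π_n(p_c)` is small (see the file header for the honest comparison; no rate is claimed). -/
theorem theta_le_exp_neg_sq_critical (hd : 2 ≤ d) {n : ℕ} (hn : 1 ≤ n) (p : unitInterval)
    (hpc : (criticalProbI d : ℝ) < p) (hp1 : (p : ℝ) < 1) :
    theta (zdGraph d) 0 p ≤ Real.exp (-(max (Real.sqrt (-Real.log (DCT16.thetaN d n (criticalProbI d))) -
        Real.sqrt ((edgesIn (zdGraph d) (box d n)).card / 8) *
          (((p : ℝ) - criticalProbI d) / ((criticalProbI d : ℝ) * (1 - p)))) 0) ^ 2) := by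
  have hpc0 : 0 < (criticalProbI d : ℝ) := by
    rw [coe_criticalProbI]; exact criticalProb_zd_pos d (by omega)
  have h1 : theta (zdGraph d) 0 p ≤ DCT16.thetaN d n p := by
    have := DCT16.theta_le_real_siteToBoundary (d := d) p n
    have hproj : Set.projIcc (0 : ℝ) 1 zero_le_one (p : ℝ) = p := Set.projIcc_val zero_le_one p
    change theta (zdGraph d) 0 p ≤ (bondPercolation (zdGraph d) (projIcc 0 1 zero_le_one (p : ℝ))).real (siteToBoundary d n)
    rw [hproj]; exact this
  exact h1.trans (thetaN_le_exp_neg_sq (by omega) hn hpc0 hpc.le hp1)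

/-! ### §5. OSSS × Level-1: the effective number of pivotal edges -/

/-- **Menshikov/OSSS made two-sided by Talagrand's Level-1 inequality.** For `d ≥ 1`, `n ≥ 1`, `r ∈ (0,1)`, with
`I_e = P_r(e pivotal for the arm event)` over the lattice edges `e` inside `Λ_n`, `θ_n = θ_n(r)` and `S_n = Σ_{k<n} θ_k(r)`:
`(n(1 − θ_n))² · Σ_e I_e² ≤ 8 · S_n² · log(1/θ_n) · (Σ_e I_e)²`, and `Σ_e I_e = θ_n'(r)` — i.e. the effective number
`(Σ I_e)²/Σ I_e²` of pivotal edges is `≥ n²(1−θ_n)²/(8 S_n² log(1/θ_n))`.  (OSSS: `nθ_n(1−θ_n) ≤ 4r(1−r)S_nΣI_e`;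
Level-1: `ΣI_e² ≤ θ_n²log(1/θ_n)/(2r²(1−r)²)`; the factors `r(1−r)` cancel.) New as typed; no claim at `p_c` beyond the
inequality itself. -/
theorem sq_mul_sum_sq_pivotal_le (hd : 1 ≤ d) {n : ℕ} (hn : 1 ≤ n) {r : ℝ} (hr : r ∈ Set.Ioo (0 : ℝ) 1) :
    ((n : ℝ) * (1 - DCT16.thetaN d n r)) ^ 2 *
        ∑ e ∈ edgesIn (zdGraph d) (box d n),
          (bondPercolation (zdGraph d) (Set.projIcc 0 1 zero_le_one r)).real {ω | IsPivotal (DKT20.armEvent 0 n) e ω} ^ 2 ≤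
      8 * (∑ k ∈ Finset.range n, DCT16.thetaN d k r) ^ 2 * (-Real.log (DCT16.thetaN d n r)) *
        (deriv (DCT16.thetaN d n) r) ^ 2 := by
  have hF := DKT20.coe_edgesIn_subset (d := d) n
  have hA := DKT20.isUpperSet_armEvent (d := d) 0 n
  have hAF := DKT20.determinedBy_armEvent (d := d) 0 n
  have hcoe : ((Set.projIcc (0 : ℝ) 1 zero_le_one r : unitInterval) : ℝ) = r :=
    congrArg Subtype.val (Set.projIcc_of_mem zero_le_one ⟨hr.1.le, hr.2.le⟩)
  -- `deriv θ_n = Σ_e I_e`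
  have hderiv := SharpThreshold.hasDerivAt_real_event hF hA hAF hr
  have hfun : (fun q : ℝ => (bondPercolation (zdGraph d) (Set.projIcc 0 1 zero_le_one q)).real (DKT20.armEvent 0 n)) =
      DCT16.thetaN d n := funext fun q => real_armEvent_zero_eq_thetaN n q
  rw [hfun] at hderiv
  set D : ℝ := ∑ e ∈ edgesIn (zdGraph d) (box d n),
    (bondPercolation (zdGraph d) (Set.projIcc 0 1 zero_le_one r)).real {ω | IsPivotal (DKT20.armEvent 0 n) e ω} with hDdef
  rw [hderiv.deriv]
  -- the two inputs
  have hosss := OneArmOSSS.oneArm_deriv_ge hd n hr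
  rw [hderiv.deriv] at hosss
  have hL1 := LevelOne.levelOne_event hF hA hAF (Set.projIcc 0 1 zero_le_one r) (by rw [hcoe]; exact hr.1)
    (by rw [hcoe]; exact hr.2)
  rw [real_armEvent_zero_eq_thetaN n r, hcoe] at hL1
  set Q : ℝ := ∑ e ∈ edgesIn (zdGraph d) (box d n),
    (bondPercolation (zdGraph d) (Set.projIcc 0 1 zero_le_one r)).real {ω | IsPivotal (DKT20.armEvent 0 n) e ω} ^ 2 with hQ
  set θ : ℝ := DCT16.thetaN d n r with hθ
  set S : ℝ := ∑ k ∈ Finset.range n, DCT16.thetaN d k r with hS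
  set L : ℝ := -Real.log θ with hL
  have hθ01 := thetaN_mem_Ioo hd hn hr
  rw [← hθ] at hθ01
  have hc : 0 < r * (1 - r) := mul_pos hr.1 (by linarith [hr.2])
  have hL0 : 0 ≤ L := by rw [hL, neg_nonneg]; exact Real.log_nonpos hθ01.1.le hθ01.2.le
  -- `2(r(1−r))² Q ≤ θ² L`
  have h1 : 2 * (r * (1 - r)) ^ 2 * Q ≤ θ ^ 2 * L := by
    have := hL1
    rw [le_div_iff₀ (by positivity)] at this
    linarith
  -- `(nθ(1−θ))² ≤ (4 r(1−r) S D)²`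
  have h0 : 0 ≤ (n : ℝ) * (θ * (1 - θ)) := by
    have := hθ01.1; have := hθ01.2; positivity
  have h2 : ((n : ℝ) * (θ * (1 - θ))) ^ 2 ≤ (4 * (r * (1 - r)) * S * D) ^ 2 := pow_le_pow_left₀ h0 hosss 2
  -- combine and cancel `2(r(1−r))²`
  have h3 : ((n : ℝ) * (1 - θ)) ^ 2 * Q * (2 * (r * (1 - r)) ^ 2) ≤ (8 * S ^ 2 * L * D ^ 2) * (2 * (r * (1 - r)) ^ 2) := by
    calc ((n : ℝ) * (1 - θ)) ^ 2 * Q * (2 * (r * (1 - r)) ^ 2)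
        = ((n : ℝ) * (1 - θ)) ^ 2 * (2 * (r * (1 - r)) ^ 2 * Q) := by ring
      _ ≤ ((n : ℝ) * (1 - θ)) ^ 2 * (θ ^ 2 * L) := mul_le_mul_of_nonneg_left h1 (sq_nonneg _)
      _ = ((n : ℝ) * (θ * (1 - θ))) ^ 2 * L := by ring
      _ ≤ (4 * (r * (1 - r)) * S * D) ^ 2 * L := mul_le_mul_of_nonneg_right h2 hL0
      _ = (8 * S ^ 2 * L * D ^ 2) * (2 * (r * (1 - r)) ^ 2) := by ring
  exact le_of_mul_le_mul_right h3 (by positivity)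

end OneArmLevelOne

end Summit.CriticalPhenomena.PercolationContinuityZ3.Theorems

end
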